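import Summits.QuantumFields.BalabanUV.T4Continuum.Spine.NE1p.DressedSmallFieldTorusWitness

/-!
# T⁴ programme, spine estimate NE1′ (node O3b/H2) — WITNESS «THE SHARP PRINT-CLAUSE END FIRES ON THE TORUS AT A TABLE SIZE THE
# FACTOR-4 ROUTE REJECTS»: S26 v1.1's torus face `attachedPart_locE_le_of_printClause_three_torus` (p225627) of the owner's SHARP END
# N0m v1.2 `attachedPart_locE_le_of_printClause_three` (p224750) applied ONCE BY NAME on W24's decided one-cube datum, at the table
# size `A₃ := (3·(e·K₀(64,8)·9·64))⁻¹ = 4∕3·A₄` where the factor-3 clause holds WITH EQUALITY and W24 §4's factor-4 clause provably FAILS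

Cell `pub-balaban`, sub-cell `t4`, row NE1′ formalisation crew (`t4/formal/NE1p/LEAVES.md`; typer R-T113: «INFO-3 … RECORDED as an
OFFER — bookable as a W24 v1.2 append-only § on an INTENT line by the leaf-04 lineage»), unit `b2b-balaban-t4-ne1p-formalise-leaf-04`
(gen 12).  A SIBLING FILE rather than W24 v1.2: W24 `Spine/NE1p/DressedSmallFieldTorusWitness.lean` v1.1 (p224686) has 381 lines and the
tree's 400-line cap would be breached by the append.  ADDITIVE — imports W24 ONLY (⇒ S24 `DressedSmallFieldGeometryFaces`, S26 v1.1
`DressedSmallFieldInductionFaces`, N0o, N0m v1.2, pv22 in its cone); THEOREMS ONLY (0 `def`, 0 `def … : Prop`, 0 cite, 0 sorry); W24's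
datum `X₀`∕`act` and sockets `hhol_torus`∕`hm_torus`∕`hL3_torus`∕`hrate_torus_num`∕`prefactor_pos`∕`prefactor4_pos`∕`dressedConst_le_one`∕
`locE_cube_live` and S26 v1.1's face BY NAME — nothing of W24 ∕ S24 ∕ S26 ∕ N0m ∕ N0o restated.

WHAT THIS FILE DOES.  W24 v1.1 §4 fires S26's factor-4 torus face `attachedPart_locE_le_of_printClause_four_torus` at the table size
`A₄ := (4·(e·K₀(64,8)·9·64))⁻¹` (intercept = slope, `r₁ = 0`, factor-4 clause `h4_torus` WITH EQUALITY).  The owner's v1.2 SHARP END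
(room 3, attained at `A₁ = A₀`) has, since S26 v1.1, a torus face with NO geometry hypothesis; this file is its first applier:
* §1 the located arithmetic at `A₃ := (3·(e·K₀(64,8)·9·64))⁻¹`: `prefactor3_pos`, `h3_torus` (the factor-3 clause
  `3·A₃·(e^{5·0+1}·K₀(64,8)·9·64) ≤ 1` WITH EQUALITY), `pencilRadius_three` (`max 2 (A₃∕A₃) = 2`), `A3_eq` (`A₃ = 4∕3·A₄`), and
  **`not_h4_at_A3`**: W24 §4's factor-4 clause is FALSE at `A₃` (`4·A₃·E = 4∕3 > 1`) — the located delta: the sharp room admits a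
  table 4∕3 larger than the factor-4 route on the SAME datum;
* §2 **`printClause_three_fires_torus`** = S26 v1.1 `attachedPart_locE_le_of_printClause_three_torus (X₀ N)` ONCE BY NAME at
  `A₀ = A₁ = A₃`, `r₁ = 0`, `R = 2·(64·log 162) + 2`, sockets = W24 §1's lemmas at the face's radius `2`; closed form
  `printClause_three_fires_torus'`: `‖E_1({0}) − E_0({0})‖ ≤ 4∕3·K₀(64,8)` (vs W24 §4's `K₀(64,8)` at `A₄`); GENUINE
  **`printClause_three_live_torus`**: the bounded quantity is `≠ 0` (W24 §3 `locE_cube_live` at `μ = 1`, slope `3A₃∕2 ≤ 1∕2`).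
Pre-history: the same three theorems were the reader's kernel check P4 of X126 (`HOME/t4/b2b-balaban-t4-ne1p-formalise-leaf-04/g12/xread/
ProbeX126.lean` d8095fcf0f326cb7, rc 0) on S26 v1.1's landed bytes; typer R-T113 recorded them as a bookable OFFER.
HONEST FRAMING.  A SHAPE inhabited on the REAL torus CARRIER (pv22's `tsys 4 N`, every `N`) with a TOY one-cube activity pencil; the
factor `3`, the clause SHAPE and `A₃` are OUR arithmetic on the owner's clause shapes and pv22's PROVED constants (`torus_consts`,
`K₀_four` through S26) — no numeral of print; (B1) `hrep`, (B3) the (2.38)-majorant `hL3` (= GAPS G-ne9p2-5, UNPRINTED; toy-true BY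
CHOICE here) and (B5)'s clause SHAPE stay DISPLAYED binders of the owner's END; nothing of Bałaban's densities ∕ (2.14) data ∕
minimisers ∕ backgrounds instantiated; discharges no wall item; the wall line v1.6 does NOT move; R-t4r2-Q2 NOT met thereby; no locus
quoted; ABSOLUTE RULE honoured ([folklore] kernel lemmas only).  NE1′ ⇐ the named binders — NOT printed, NOT proved; spine PROVED 0∕9;
count 9 unchanged.  Rung (B)+1 on ONE finite four-torus — NOT infinite volume, NOT a mass gap, NOT OS on ℝ⁴, NOT Clay.  HONEST
DEPENDENCY: continuum YM on T⁴ ⇐ BetaPertH ∧ nine spine estimates (0/9 proved); BetaPertH ⇐ (D1) ∧ (D4) ∧ CAP+tail; G-an2-4 gates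
asym, D1 and NE2/3/4.
-/

noncomputable section

namespace Summit.QuantumFields.BalabanUV.T4Continuum.NE1p.DressedSmallFieldTorusWitnessSharp

open Metric Set Complex
open Literature.MathematicalPhysics.QuantumFieldTheory.Balaban1983to89.B12TreeDecay (K₀ K₀_pos)
open Literature.MathematicalPhysics.QuantumFieldTheory.Balaban1983to89.B13Resummation (locE)
open Literature.MathematicalPhysics.QuantumFieldTheory.Balaban1983to89.TreeLengthTorus (tsys torusTreeLen)
open Literature.MathematicalPhysics.QuantumFieldTheory.Balaban1983to89.TreeLengthTorusGeometry (TTouch)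
open Summit.QuantumFields.BalabanUV.T4Continuum.NE1p.DressedSmallFieldInductionFaces (attachedPart_locE_le_of_printClause_three_torus)
open Summit.QuantumFields.BalabanUV.T4Continuum.NE1p.DressedSmallFieldTorusWitness (X₀ act hhol_torus hm_torus hL3_torus
  hrate_torus_num prefactor_pos prefactor4_pos dressedConst_le_one locE_cube_live)

variable (N : ℕ) [NeZero N]

/-! ## §1 THE LOCATED ARITHMETIC AT `A₃ := (3·(e·K₀(64,8)·9·64))⁻¹` — the factor-3 clause with EQUALITY; the factor-4 clause FAILS -/

omit [NeZero N] in
/-- The located «factor-3» prefactor `3·(e·K₀(64,8)·9·64)` is positive. [folklore] -/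
theorem prefactor3_pos : 0 < 3 * (Real.exp 1 * K₀ 64 8 * 9 * 64) := mul_pos three_pos prefactor_pos

omit [NeZero N] in
/-- THE SHARP FACTOR-3 CLAUSE `h3` OF THE OWNER's v1.2 END WITH EQUALITY at `r₁ = 0`, `A₀ := A₃ = (3·(e·K₀(64,8)·9·64))⁻¹`, in S26's located
numerals. [folklore] -/
theorem h3_torus : 3 * (3 * (Real.exp 1 * K₀ 64 8 * 9 * 64))⁻¹ * (Real.exp (5 * 0 + 1) * K₀ 64 8 * 9 * 64) ≤ 1 := by
  rw [mul_zero, zero_add]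
  rw [show 3 * (3 * (Real.exp 1 * K₀ 64 8 * 9 * 64))⁻¹ * (Real.exp 1 * K₀ 64 8 * 9 * 64) =
      (3 * (Real.exp 1 * K₀ 64 8 * 9 * 64))⁻¹ * (3 * (Real.exp 1 * K₀ 64 8 * 9 * 64)) by ring, inv_mul_cancel₀ prefactor3_pos.ne']

omit [NeZero N] in
/-- THE FACE's OWN PENCIL RADIUS at equal intercept and slope: `max 2 (A₃∕A₃) = 2`. [folklore] -/
theorem pencilRadius_three :
    max 2 ((3 * (Real.exp 1 * K₀ 64 8 * 9 * 64))⁻¹ / (3 * (Real.exp 1 * K₀ 64 8 * 9 * 64))⁻¹) = (2 : ℝ) := by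
  rw [div_self (inv_pos.2 prefactor3_pos).ne', max_eq_left (by norm_num : (1 : ℝ) ≤ 2)]

omit [NeZero N] in
/-- `A₃ = 4∕3·A₄`: the sharp room admits a table one third larger than W24 §4's `A₄ = (4·(e·K₀(64,8)·9·64))⁻¹`. [folklore] -/
theorem A3_eq : (3 * (Real.exp 1 * K₀ 64 8 * 9 * 64))⁻¹ = 4 / 3 * (4 * (Real.exp 1 * K₀ 64 8 * 9 * 64))⁻¹ := by
  have h := prefactor_pos.ne'
  field_simp

omit [NeZero N] in
/-- **THE LOCATED DELTA**: W24 §4's factor-4 clause `h4` is FALSE at the table size `A₃` (`4·A₃·(e¹·K₀(64,8)·9·64) = 4∕3 > 1`) — the factor-4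
route `attachedPart_locE_le_of_printClause_four_torus` does NOT admit `A₃`; only the owner's SHARP END does (§2). [folklore] -/
theorem not_h4_at_A3 : ¬ 4 * (3 * (Real.exp 1 * K₀ 64 8 * 9 * 64))⁻¹ * (Real.exp (5 * 0 + 1) * K₀ 64 8 * 9 * 64) ≤ 1 := by
  rw [mul_zero, zero_add]
  rw [show 4 * (3 * (Real.exp 1 * K₀ 64 8 * 9 * 64))⁻¹ * (Real.exp 1 * K₀ 64 8 * 9 * 64) =
      4 / 3 * ((Real.exp 1 * K₀ 64 8 * 9 * 64)⁻¹ * (Real.exp 1 * K₀ 64 8 * 9 * 64)) by ring, inv_mul_cancel₀ prefactor_pos.ne']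
  norm_num

/-! ## §2 THE SHARP END FIRES — S26 v1.1 `attachedPart_locE_le_of_printClause_three_torus` applied ONCE BY NAME on W24's datum -/

open Classical in
/-- **THE SHARP PRINT-CLAUSE END OF NE1′'s SMALL-FIELD INDUCTION FIRES ON BAŁABAN's PERIODIC CARRIER AT `A₃`**: S26 v1.1
`DressedSmallFieldInductionFaces.attachedPart_locE_le_of_printClause_three_torus` BY NAME, ONE application, conclusion LITERAL at
`A₀ = A₁ = A₃ := (3·(e·K₀(64,8)·9·64))⁻¹`, `r₁ = 0`, `R = 2·(64·log 162) + 2`; sockets = W24 §1's `hhol_torus` ∕ `hm_torus` ∕ `hL3_torus` at the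
face's radius `max 2 (A₃∕A₃)` (= 2 by `pencilRadius_three`), `hrate_torus_num`, `h3_torus` (EQUALITY), `hle` by `le_rfl`.  The attached part
`E_1({0}) − E_0({0})` of the table-strength pencil of slope `3A₃∕2` is `≤ 4·(e·9·64·K₀(64,8)²)·A₃·e⁰`. [folklore] -/
theorem printClause_three_fires_torus :
    ‖locE (TTouch (d := 4) (N := N)) (fun Z : (tsys 4 N).Dom => Z.1)
          (act N (((3 * (Real.exp 1 * K₀ 64 8 * 9 * 64))⁻¹ + 2 * (3 * (Real.exp 1 * K₀ 64 8 * 9 * 64))⁻¹) / 2) 1) (X₀ N).1 -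
        locE (TTouch (d := 4) (N := N)) (fun Z : (tsys 4 N).Dom => Z.1)
          (act N (((3 * (Real.exp 1 * K₀ 64 8 * 9 * 64))⁻¹ + 2 * (3 * (Real.exp 1 * K₀ 64 8 * 9 * 64))⁻¹) / 2) 0) (X₀ N).1‖ ≤
      4 * (Real.exp 1 * 9 * 64 * K₀ 64 8 ^ 2) * (3 * (Real.exp 1 * K₀ 64 8 * 9 * 64))⁻¹ * Real.exp (-(0 * torusTreeLen (X₀ N).1)) := by
  have hA : (0 : ℝ) ≤ (3 * (Real.exp 1 * K₀ 64 8 * 9 * 64))⁻¹ := inv_nonneg.2 prefactor3_pos.le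
  have hA3 : (0 : ℝ) ≤ (3 * (Real.exp 1 * K₀ 64 8 * 9 * 64))⁻¹ + 2 * (3 * (Real.exp 1 * K₀ 64 8 * 9 * 64))⁻¹ := by positivity
  refine attachedPart_locE_le_of_printClause_three_torus (X₀ N)
    (m := fun Z : (tsys 4 N).Dom =>
      if Z.1 = {0} then (3 * (Real.exp 1 * K₀ 64 8 * 9 * 64))⁻¹ + 2 * (3 * (Real.exp 1 * K₀ 64 8 * 9 * 64))⁻¹ else 0)
    (R := 2 * (64 * Real.log 162) + 2)
    hA (inv_pos.2 prefactor3_pos) le_rfl le_rfl hrate_torus_num h3_torus (hhol_torus N _ _ (X₀ N)) ?_ ?_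
  · rw [pencilRadius_three]; exact hm_torus N hA3 two_pos (X₀ N)
  · rw [pencilRadius_three]; exact hL3_torus N hA3 _ (X₀ N)

open Classical in
/-- CLOSED FORM: the sharp END's bound on the torus datum at `A₃` is `‖E_1({0}) − E_0({0})‖ ≤ 4∕3·K₀(64,8)` (`4·e·9·64·K₀²·A₃ = 4∕3·K₀`, decay
`e⁰ = 1`) — against W24 §4's `K₀(64,8)` at `A₄` (`printClause_fires_torus'`). [folklore] -/
theorem printClause_three_fires_torus' :
    ‖locE (TTouch (d := 4) (N := N)) (fun Z : (tsys 4 N).Dom => Z.1)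
          (act N (((3 * (Real.exp 1 * K₀ 64 8 * 9 * 64))⁻¹ + 2 * (3 * (Real.exp 1 * K₀ 64 8 * 9 * 64))⁻¹) / 2) 1) (X₀ N).1 -
        locE (TTouch (d := 4) (N := N)) (fun Z : (tsys 4 N).Dom => Z.1)
          (act N (((3 * (Real.exp 1 * K₀ 64 8 * 9 * 64))⁻¹ + 2 * (3 * (Real.exp 1 * K₀ 64 8 * 9 * 64))⁻¹) / 2) 0) (X₀ N).1‖ ≤
      4 / 3 * K₀ 64 8 := by
  have h := printClause_three_fires_torus N
  rw [zero_mul, neg_zero, Real.exp_zero, mul_one] at h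
  refine h.trans (le_of_eq ?_)
  have hK : K₀ (64 : ℝ) 8 ≠ 0 := (K₀_pos _ _).ne'
  have he : Real.exp 1 ≠ 0 := (Real.exp_pos 1).ne'
  field_simp

open Classical in
/-- **GENUINE AT ITS OWN LETTERS**: the quantity bounded by `printClause_three_fires_torus` is `≠ 0` — the attached table is LIVE at `A₃`
(`E_1({0}) ≠ E_0({0})`: exponentials `1 + 3A₃∕2 ≠ 1`, by W24 §3 `locE_cube_live` at `μ = 1`; the slope `3A₃∕2 ≤ 1∕2 < 1` by
`dressedConst_le_one`). [folklore] -/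
theorem printClause_three_live_torus :
    locE (TTouch (d := 4) (N := N)) (fun Z : (tsys 4 N).Dom => Z.1)
          (act N (((3 * (Real.exp 1 * K₀ 64 8 * 9 * 64))⁻¹ + 2 * (3 * (Real.exp 1 * K₀ 64 8 * 9 * 64))⁻¹) / 2) 1) (X₀ N).1 ≠
      locE (TTouch (d := 4) (N := N)) (fun Z : (tsys 4 N).Dom => Z.1)
          (act N (((3 * (Real.exp 1 * K₀ 64 8 * 9 * 64))⁻¹ + 2 * (3 * (Real.exp 1 * K₀ 64 8 * 9 * 64))⁻¹) / 2) 0) (X₀ N).1 := by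
  have hc : (0 : ℝ) < ((3 * (Real.exp 1 * K₀ 64 8 * 9 * 64))⁻¹ + 2 * (3 * (Real.exp 1 * K₀ 64 8 * 9 * 64))⁻¹) / 2 := by
    have := inv_pos.2 prefactor3_pos; positivity
  refine locE_cube_live N hc (μ := 1) ?_ one_ne_zero
  rw [norm_one, one_mul]
  have h1 : (3 * (Real.exp 1 * K₀ 64 8 * 9 * 64))⁻¹ ≤ 1 / 3 := by
    rw [mul_inv, show (1 : ℝ) / 3 = 3⁻¹ * 1 by norm_num]
    exact mul_le_mul_of_nonneg_left dressedConst_le_one (by norm_num)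
  linarith

open Classical in
/-- (E) ONE CURRENCY WITH W24 §4, IN KERNEL: W24's `printClause_fires_torus` statement (factor-4 face at `A₄`) is ALSO one term of the SHARP face
— `h4_torus ⇒ h3` at `A₄` (`3·A₄·E ≤ 4·A₄·E ≤ 1`); so on W24's datum the sharp END covers every table size the factor-4 END covers, and
`A₃` besides (`not_h4_at_A3`).  No new inequality. [folklore] -/
example :
    ‖locE (TTouch (d := 4) (N := N)) (fun Z : (tsys 4 N).Dom => Z.1)
          (act N (((4 * (Real.exp 1 * K₀ 64 8 * 9 * 64))⁻¹ + 2 * (4 * (Real.exp 1 * K₀ 64 8 * 9 * 64))⁻¹) / 2) 1) (X₀ N).1 -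
        locE (TTouch (d := 4) (N := N)) (fun Z : (tsys 4 N).Dom => Z.1)
          (act N (((4 * (Real.exp 1 * K₀ 64 8 * 9 * 64))⁻¹ + 2 * (4 * (Real.exp 1 * K₀ 64 8 * 9 * 64))⁻¹) / 2) 0) (X₀ N).1‖ ≤
      4 * (Real.exp 1 * 9 * 64 * K₀ 64 8 ^ 2) * (4 * (Real.exp 1 * K₀ 64 8 * 9 * 64))⁻¹ * Real.exp (-(0 * torusTreeLen (X₀ N).1)) := by
  have hA : (0 : ℝ) ≤ (4 * (Real.exp 1 * K₀ 64 8 * 9 * 64))⁻¹ := inv_nonneg.2 prefactor4_pos.le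
  have hA3 : (0 : ℝ) ≤ (4 * (Real.exp 1 * K₀ 64 8 * 9 * 64))⁻¹ + 2 * (4 * (Real.exp 1 * K₀ 64 8 * 9 * 64))⁻¹ := by positivity
  have h3 : 3 * (4 * (Real.exp 1 * K₀ 64 8 * 9 * 64))⁻¹ * (Real.exp (5 * 0 + 1) * K₀ 64 8 * 9 * 64) ≤ 1 := by
    rw [mul_zero, zero_add]
    rw [show 3 * (4 * (Real.exp 1 * K₀ 64 8 * 9 * 64))⁻¹ * (Real.exp 1 * K₀ 64 8 * 9 * 64) =
        3 / 4 * ((Real.exp 1 * K₀ 64 8 * 9 * 64)⁻¹ * (Real.exp 1 * K₀ 64 8 * 9 * 64)) by ring, inv_mul_cancel₀ prefactor_pos.ne']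
    norm_num
  have hrad : max 2 ((4 * (Real.exp 1 * K₀ 64 8 * 9 * 64))⁻¹ / (4 * (Real.exp 1 * K₀ 64 8 * 9 * 64))⁻¹) = (2 : ℝ) := by
    rw [div_self (inv_pos.2 prefactor4_pos).ne', max_eq_left (by norm_num : (1 : ℝ) ≤ 2)]
  refine attachedPart_locE_le_of_printClause_three_torus (X₀ N)
    (m := fun Z : (tsys 4 N).Dom =>
      if Z.1 = {0} then (4 * (Real.exp 1 * K₀ 64 8 * 9 * 64))⁻¹ + 2 * (4 * (Real.exp 1 * K₀ 64 8 * 9 * 64))⁻¹ else 0)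
    (R := 2 * (64 * Real.log 162) + 2)
    hA (inv_pos.2 prefactor4_pos) le_rfl le_rfl hrate_torus_num h3 (hhol_torus N _ _ (X₀ N)) ?_ ?_
  · rw [hrad]; exact hm_torus N hA3 two_pos (X₀ N)
  · rw [hrad]; exact hL3_torus N hA3 _ (X₀ N)

end Summit.QuantumFields.BalabanUV.T4Continuum.NE1p.DressedSmallFieldTorusWitnessSharp

end
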